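import Mathlib.Data.Real.Basic
import Mathlib.Tactic
import HarnessLib

/-!
# QUANT lane R8 — backward running averages of a "no rise after a fall" sequence have no interior minimum

builds on p205010 (kernel theorem, internal audit signed; external expert review pending)

Support file (`--supports stmt-CriticalPhenomena-4575`), QUANT lane lead (gen 9), rung R8 of `run/shared/lean/prim/quant/LADDER.md`;
memo `prim-quant-lead-g9/LEAD-NOTES-G9.md` N20 step (3) — second file of the kernel proof of FAR (`Quant.FarTreeRow`) at EVERY layer on
COMBS.  Pure real arithmetic, no probability.

Along the spine of a comb (levels `0..n`, prefix products `π`), the conditional probabilities `q(k) = P(N^{−b} = j | spine open to level k)`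
satisfy the backward recursion `q(k) = (1 − λ_{k+1})·a_k + λ_{k+1}·q(k+1)`, `q(n) = a_n`, with `λ_{k+1} = π_{k+1}/π_k ∈ [0,1]` and
`a_k = P(C_k = j)` a sequence with NO RISE AFTER A FALL (`…QuantCombCountLaw.lean`).

* `Quant.chainAvg_le_of_bound` — if `A_i ≤ M` on `[k, l)` and `Q_l ≤ M` then `Q_k ≤ M`.
* `Quant.chainAvg_zero_le_of_lt_succ` — local form: `Q_k < Q_{k+1} ⟹ Q_0 ≤ Q_k` (`A_k ≤ Q_k < Q_{k+1}` forces a later `A_i > A_k`, hence no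
  earlier fall, hence `A ≤ A_k ≤ Q_k` before `k`); `Quant.chainAvg_noInteriorMin` — **no interior minimum**: `min(Q_0, Q_{ℓ'}) ≤ Q_ℓ`
  for `ℓ ≤ ℓ' ≤ n` (induction on `ℓ'`).
* `Quant.comb_tail_le_of_bound` — the spine tails `e_k = Σ_{i ≥ k} (π_i − π_{i+1}) a_i` satisfy `e_k ≤ π_k·M` when `a ≤ M` on `[k, d]`.
* `Quant.comb_noInteriorMin` — the form consumed by the relocation lemma: with `e_k = (π_k − π_{k+1}) a_k + e_{k+1}`, `e_{d+1} = π_{d+1} = 0`,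
  `π_{m+1} ≤ T ≤ π_m`, `ℓ ≤ m ≤ d`:  `min(T·e_0/π_0, (T − π_{m+1})·a_m + e_{m+1}) ≤ T·e_ℓ/π_ℓ` — the hair with marginal `T` at level `ℓ`
  costs at least as much as the cheaper of "moved to the root" and "spliced into the spine at weight `T`" (the refined chain with an extra
  level of weight `T` after `m` is again a backward-average chain of a no-rise-after-a-fall sequence).
[this work]
-/

noncomputable section

namespace Summit.CriticalPhenomena.PercolationContinuityZ3.Theorems

namespace Quant

open scoped Classical

/-! ### Backward-average chains -/

/-- If `A i ≤ M` for `k ≤ i < l` and `Q l ≤ M`, then `Q k ≤ M` along a backward-average chain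
`Q i = (1 − λ (i+1))·A i + λ (i+1)·Q (i+1)` (`i < n`, `λ ∈ [0,1]`), for `k ≤ l ≤ n`. [this work] -/
theorem chainAvg_le_of_bound (n : ℕ) (A Q lam : ℕ → ℝ) (hlam0 : ∀ k, 0 ≤ lam k) (hlam1 : ∀ k, lam k ≤ 1)
    (hrec : ∀ k < n, Q k = (1 - lam (k + 1)) * A k + lam (k + 1) * Q (k + 1))
    {k l : ℕ} (hkl : k ≤ l) (hln : l ≤ n) {M : ℝ} (hA : ∀ i, k ≤ i → i < l → A i ≤ M) (hQ : Q l ≤ M) :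
    Q k ≤ M := by
  obtain ⟨d, rfl⟩ : ∃ d, l = k + d := ⟨l - k, by omega⟩
  induction d generalizing k with
  | zero => simpa using hQ
  | succ d ih =>
    have hk : k < n := by omega
    have h1 : Q (k + 1) ≤ M :=
      ih (by omega) (by omega) (fun i hi hi' => hA i (by omega) (by omega)) (by rwa [show k + 1 + d = k + (d + 1) by ring])
    have h2 : A k ≤ M := hA k le_rfl (by omega)
    rw [hrec k hk]
    nlinarith [hlam0 (k + 1), hlam1 (k + 1)]

/-- **Local form of the no-interior-minimum property**: if `Q k < Q (k+1)` (`k < n`) then `Q 0 ≤ Q k`.  (From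
`Q k < Q (k+1)` we get `A k ≤ Q k < Q (k+1)`, so some later `A i` exceeds `A k`; by "no rise after a fall" no earlier `A i` exceeds
`A k`, hence `A ≤ Q k` before `k` and `Q 0 ≤ Q k`.) [this work] -/
theorem chainAvg_zero_le_of_lt_succ (n : ℕ) (A Q lam : ℕ → ℝ) (hlam0 : ∀ k, 0 ≤ lam k) (hlam1 : ∀ k, lam k ≤ 1)
    (hrec : ∀ k < n, Q k = (1 - lam (k + 1)) * A k + lam (k + 1) * Q (k + 1)) (hend : Q n = A n)
    (hU : ∀ i k l, i < k → k ≤ l → l ≤ n → A k < A i → A l ≤ A k)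
    {k : ℕ} (hk : k < n) (hlt : Q k < Q (k + 1)) : Q 0 ≤ Q k := by
  -- `A k ≤ Q k`
  have hAk : A k ≤ Q k := by
    have h := hrec k hk
    by_cases hl1 : lam (k + 1) = 1
    · rw [hl1] at h; simp at h; rw [h] at hlt; exact absurd hlt (lt_irrefl _)
    · have hl : lam (k + 1) < 1 := lt_of_le_of_ne (hlam1 _) hl1
      nlinarith [hlam0 (k + 1)]
  -- no fall happened before `k`: `A i ≤ A k` for `i < k`
  have hbefore : ∀ i < k, A i ≤ A k := by
    intro i hi
    by_contra h
    push Not at h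
    have htail : ∀ l, k ≤ l → l ≤ n → A l ≤ A k := fun l h1 h2 => hU i k l hi h1 h2 h
    have hQ1 : Q (k + 1) ≤ A k :=
      chainAvg_le_of_bound n A Q lam hlam0 hlam1 hrec (k := k + 1) (l := n) (by omega) le_rfl
        (fun l h1 h2 => htail l (by omega) (by omega)) (by rw [hend]; exact htail n (by omega) le_rfl)
    linarith
  exact chainAvg_le_of_bound n A Q lam hlam0 hlam1 hrec (k := 0) (l := k) (Nat.zero_le _) (by omega)
    (fun i _ hi => (hbefore i hi).trans hAk) le_rfl

/-- **No interior minimum.**  For a backward-average chain of a sequence `A` with no rise after a fall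
(`i < k ≤ l ≤ n`, `A k < A i ⟹ A l ≤ A k`) and `Q n = A n`: `min (Q 0) (Q ℓ') ≤ Q ℓ` whenever `ℓ ≤ ℓ' ≤ n`. [this work] -/
theorem chainAvg_noInteriorMin (n : ℕ) (A Q lam : ℕ → ℝ) (hlam0 : ∀ k, 0 ≤ lam k) (hlam1 : ∀ k, lam k ≤ 1)
    (hrec : ∀ k < n, Q k = (1 - lam (k + 1)) * A k + lam (k + 1) * Q (k + 1)) (hend : Q n = A n)
    (hU : ∀ i k l, i < k → k ≤ l → l ≤ n → A k < A i → A l ≤ A k)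
    {ℓ ℓ' : ℕ} (hℓ : ℓ ≤ ℓ') (hℓ' : ℓ' ≤ n) : min (Q 0) (Q ℓ') ≤ Q ℓ := by
  induction ℓ' generalizing ℓ with
  | zero => have : ℓ = 0 := by omega
            subst this; exact min_le_left _ _
  | succ r ih =>
    rcases Nat.lt_or_ge ℓ (r + 1) with h | h
    · have h1 : min (Q 0) (Q r) ≤ Q ℓ := ih (by omega) (by omega)
      by_cases hstep : Q r < Q (r + 1)
      · have h0 : Q 0 ≤ Q r := chainAvg_zero_le_of_lt_succ n A Q lam hlam0 hlam1 hrec hend hU (by omega) hstep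
        have : min (Q 0) (Q r) = Q 0 := min_eq_left h0
        rw [this] at h1
        exact (min_le_left _ _).trans h1
      · push Not at hstep
        exact le_trans (min_le_min le_rfl hstep) h1
    · have : ℓ = r + 1 := by omega
      subst this; exact min_le_right _ _

/-! ### The spine tails of a comb -/

/-- Tail bound: if `e k = (π k − π (k+1))·a k + e (k+1)` for `k ≤ d`, `e (d+1) = 0`, `π (d+1) = 0`, `π` non-increasing on `[k, d+1]`,
and `a i ≤ M` for `k ≤ i ≤ d`, then `e k ≤ π k · M`. [this work] -/
theorem comb_tail_le_of_bound (d : ℕ) (π a e : ℕ → ℝ) (hanti : ∀ k ≤ d, π (k + 1) ≤ π k) (hπd : π (d + 1) = 0)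
    (he : ∀ k ≤ d, e k = (π k - π (k + 1)) * a k + e (k + 1)) (hed : e (d + 1) = 0)
    {k : ℕ} (hk : k ≤ d + 1) {M : ℝ} (hA : ∀ i, k ≤ i → i ≤ d → a i ≤ M) : e k ≤ π k * M := by
  obtain ⟨r, hr⟩ : ∃ r, k + r = d + 1 := ⟨d + 1 - k, by omega⟩
  induction r generalizing k with
  | zero => rw [add_zero] at hr; subst hr; rw [hed, hπd, zero_mul]
  | succ r ih =>
    have hkd : k ≤ d := by omega
    have h1 : e (k + 1) ≤ π (k + 1) * M := ih (by omega) (fun i h1 h2 => hA i (by omega) h2) (by omega)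
    rw [he k hkd]
    nlinarith [hanti k hkd, hA k le_rfl hkd]

/-- **No interior minimum, comb form.**  Levels `0..d` with prefix products `π` (positive, non-increasing, `π (d+1) = 0`), a sequence `a`
with no rise after a fall on `[0, d]`, tails `e k = (π k − π (k+1)) a k + e (k+1)` (`e (d+1) = 0`).  For a weight `T` with
`π (m+1) ≤ T ≤ π m` (`m ≤ d`) and a level `ℓ ≤ m`:
`min (T·e 0/π 0) ((T − π (m+1))·a m + e (m+1)) ≤ T·e ℓ/π ℓ`. [this work] -/
theorem comb_noInteriorMin (d : ℕ) (π a e : ℕ → ℝ) (hpos : ∀ k ≤ d, 0 < π k) (hanti : ∀ k ≤ d, π (k + 1) ≤ π k)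
    (hπd : π (d + 1) = 0) (he : ∀ k ≤ d, e k = (π k - π (k + 1)) * a k + e (k + 1)) (hed : e (d + 1) = 0)
    (hU : ∀ i k l, i < k → k ≤ l → l ≤ d → a k < a i → a l ≤ a k)
    {m ℓ : ℕ} (hm : m ≤ d) (hℓ : ℓ ≤ m) {T : ℝ} (hT0 : 0 < T) (hT1 : T ≤ π m) (hT2 : π (m + 1) ≤ T) :
    min (T * e 0 / π 0) ((T - π (m + 1)) * a m + e (m + 1)) ≤ T * e ℓ / π ℓ := by
  -- the chain `Q k = e k / π k`, refined by one level of weight `T` after `m`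
  set Qn : ℝ := ((T - π (m + 1)) * a m + e (m + 1)) / T with hQn
  set A' : ℕ → ℝ := fun k => if k ≤ m then a k else Qn with hA'
  set Q' : ℕ → ℝ := fun k => if k ≤ m then e k / π k else Qn with hQ'
  set lam : ℕ → ℝ := fun k => if k ≤ m then π k / π (k - 1) else min 1 (T / π m) with hlam
  have hπm : 0 < π m := hpos m hm
  have hlam0 : ∀ k, 0 ≤ lam k := by
    intro k; simp only [hlam]
    split_ifs with h
    · exact div_nonneg (hpos k (by omega)).le (hpos (k - 1) (by omega)).le
    · exact le_min zero_le_one (div_nonneg hT0.le hπm.le)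
  have hlam1 : ∀ k, lam k ≤ 1 := by
    intro k; simp only [hlam]
    split_ifs with h
    · rw [div_le_one (hpos (k - 1) (by omega))]
      rcases Nat.eq_zero_or_pos k with h0 | h0
      · subst h0; exact le_rfl
      · have := hanti (k - 1) (by omega)
        rwa [show k - 1 + 1 = k by omega] at this
    · exact min_le_left _ _
  -- the recursion of the refined chain on `[0, m+1]`
  have hrec : ∀ k < m + 1, Q' k = (1 - lam (k + 1)) * A' k + lam (k + 1) * Q' (k + 1) := by
    intro k hk
    have hkm : k ≤ m := by omega
    simp only [hQ', hA', hlam, hkm, ↓reduceIte, show k + 1 - 1 = k by omega]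
    by_cases hk1 : k + 1 ≤ m
    · simp only [hk1, ↓reduceIte]
      have hπk : 0 < π k := hpos k (by omega)
      have hπk1 : 0 < π (k + 1) := hpos (k + 1) (by omega)
      rw [he k (by omega)]
      field_simp
    · have hkm' : k = m := by omega
      subst hkm'
      simp only [hk1, ↓reduceIte]
      have hmin : min 1 (T / π k) = T / π k := min_eq_right (by rw [div_le_one hπm]; exact hT1)
      rw [hmin, he k hm, hQn]
      field_simp
      ring
  have hend : Q' (m + 1) = A' (m + 1) := by simp [hQ', hA']
  -- no rise after a fall survives the refinement
  have hU' : ∀ i k l, i < k → k ≤ l → l ≤ m + 1 → A' k < A' i → A' l ≤ A' k := by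
    intro i k l hik hkl hl hfall
    have him : i ≤ m := by omega
    by_cases hkm : k ≤ m
    · simp only [hA', him, hkm, ↓reduceIte] at hfall ⊢
      by_cases hlm : l ≤ m
      · simp only [hlm, ↓reduceIte]; exact hU i k l hik hkl (by omega) hfall
      · simp only [hlm, ↓reduceIte, hQn]
        -- `Qn ≤ a k`: every `a` on `[k, d]` is `≤ a k`
        have htail : ∀ l', k ≤ l' → l' ≤ d → a l' ≤ a k := fun l' h1 h2 => hU i k l' hik h1 h2 hfall
        have h1 : e (m + 1) ≤ π (m + 1) * a k :=
          comb_tail_le_of_bound d π a e hanti hπd he hed (by omega) fun i' h1 h2 => htail i' (by omega) h2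
        have h2 : (T - π (m + 1)) * a m ≤ (T - π (m + 1)) * a k :=
          mul_le_mul_of_nonneg_left (htail m hkm hm) (by linarith)
        rw [div_le_iff₀ hT0]
        nlinarith
    · have : k = l := by omega
      subst this; exact le_rfl
  -- apply the abstract lemma on `[0, m+1]` with `ℓ ≤ m+1`
  have key := chainAvg_noInteriorMin (m + 1) A' Q' lam hlam0 hlam1 hrec hend hU' (ℓ := ℓ) (ℓ' := m + 1) (by omega) le_rfl
  have hQ0 : Q' 0 = e 0 / π 0 := by simp [hQ']
  have hQℓ : Q' ℓ = e ℓ / π ℓ := by simp [hQ', hℓ]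
  have hQm1 : Q' (m + 1) = Qn := by simp [hQ']
  rw [hQ0, hQℓ, hQm1] at key
  -- multiply through by `T > 0`
  have hT : T * min (e 0 / π 0) Qn = min (T * e 0 / π 0) ((T - π (m + 1)) * a m + e (m + 1)) := by
    rw [mul_min_of_nonneg _ _ hT0.le, hQn, mul_div_assoc, mul_div_cancel₀ _ hT0.ne']
  rw [← hT, mul_div_assoc]
  exact mul_le_mul_of_nonneg_left key hT0.le

end Quant

end Summit.CriticalPhenomena.PercolationContinuityZ3.Theorems

end
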